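import Literature.Probability.RandomPlanarGeometry.SAWStripTMBound
import Literature.Probability.RandomPlanarGeometry.SAWStripTMEval
import Literature.Probability.RandomPlanarGeometry.SAWStripTMEval6
import Literature.Probability.RandomPlanarGeometry.SAWRenewalBound
import Mathlib.Algebra.Field.GeomSum
import HarnessLib

/-!
# `2.6 ≤ μ(ℤ²)`: Kesten's bound from span-limited irreducible bridges (assembly)

Topic `Literature/Probability/RandomPlanarGeometry`. The lower half of the bounds on the planar
connective constant quoted by Lawler–Schramm–Werner (2004, §3.1), by the method of Kesten (1963)
as implemented by Alm–Parviainen and Jensen (2004, §2: irreducible bridges of bounded span counted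
by transfer matrices): the set `S` of irreducible bridges consisting of

* the span-1 family `[+e₀]`, `[+e₀] ++ k·[+e₁]`, `[+e₀] ++ k·[-e₁]` (`k ≤ 60`), Kraft sum
  `5/13 + 2 Σ_{k=1}^{60} (5/13)^{k+1} = 0.86538…` at fugacity `5/13 = 1/2.6`, and
* the decoded accepted traces of the certified strip transfer matrices of spans `2, …, 6`
  (`StripTM.kraft_ge` with the compiled values `StripTM.dp_two`, …, `StripTM.dp_six`), Kraft sum
  `≥ 0.13613`,

has total Kraft sum `≥ 1.0015 ≥ 1`, so `Renewal.le_connectiveConstant_of_kraft` gives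
**`le_connectiveConstant_26 : 2.6 ≤ μ(ℤ²)`**. (Jensen's span `≤ 15` to length `250` gives
`2.625622`; span `≤ 6` in an `81`-row window is what fits the kernel-checked budget, and suffices.)

## References

* I. Jensen, *Improved lower bounds on the connective constants for two-dimensional self-avoiding
  walks*, J. Phys. A 37 (2004) 11521–11529, §2, eq. (3)–(4).
* H. Kesten, *On the number of self-avoiding walks*, J. Math. Phys. 4 (1963) 960–969.
* G. F. Lawler, O. Schramm, W. Werner, *On the scaling limit of planar self-avoiding walk* (2004), §3.1.
-/

open Finset Literature.Probability.LatticeModels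
open scoped BigOperators

namespace Literature.Probability.RandomPlanarGeometry.SAW

/-! ### The span-1 irreducible bridges -/

/-- The vertical stick `[+e₀] ++ k·[d]`. [cite: Jensen2004SAWLowerBounds, §2.1] -/
def vertWord (d : Step) (k : ℕ) : List Step := (0 : Step) :: List.replicate k d

/-- Length of a stick. [folklore] -/
@[simp] theorem length_vertWord (d : Step) (k : ℕ) : (vertWord d k).length = k + 1 := by simp [vertWord]

/-- Coordinates along a vertical stick (`d` vertical). [folklore] -/
theorem traj_vertWord {d : Step} (hd : Step.dx d = 0) (k : ℕ) :
    ∀ i ≤ k, traj (vertWord d k) (i + 1) 0 = 1 ∧ traj (vertWord d k) (i + 1) 1 = i * Step.dy d := by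
  intro i
  induction i with
  | zero => intro; simp [vertWord, traj, Step.vec, Step.dx, Step.dy]
  | succ i ih =>
    intro hi
    obtain ⟨h0, h1⟩ := ih (by omega)
    have hlen : i + 1 < (vertWord d k).length := by simp; omega
    have hget : (vertWord d k)[i + 1] = d := by simp [vertWord]
    rw [traj_succ _ hlen, hget]
    refine ⟨by simp [h0, hd], ?_⟩
    simp only [Pi.add_apply, Step.vec_apply_one, h1]; push_cast; ring

/-- **The vertical sticks are irreducible bridges of span 1.** [cite: Jensen2004SAWLowerBounds, §2.1] -/
theorem isIrrBridge_vertWord {d : Step} (hd : Step.dx d = 0) (hdy : Step.dy d ≠ 0) (k : ℕ) :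
    IsIrrBridge (vertWord d k) ∧ xEnd (vertWord d k) = 1 := by
  have hco := traj_vertWord hd k
  have hx : ∀ i, 1 ≤ i → i ≤ k + 1 → xAt (vertWord d k) i = 1 := by
    intro i h1 h2
    obtain ⟨j, rfl⟩ : ∃ j, i = j + 1 := ⟨i - 1, by omega⟩
    exact (hco j (by omega)).1
  have hend : xEnd (vertWord d k) = 1 := by rw [xEnd, length_vertWord]; exact hx _ (by omega) le_rfl
  refine ⟨⟨?_, ?_, ?_, by simp [vertWord]⟩, hend⟩
  · rw [isSAW_iff_injOn]
    intro i hi j hj hij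
    simp only [Set.mem_setOf_eq, length_vertWord] at hi hj
    have key : ∀ i ≤ k + 1, (traj (vertWord d k) i 0 = if i = 0 then 0 else 1) ∧
        (i ≠ 0 → traj (vertWord d k) i 1 = (i - 1 : ℕ) * Step.dy d) := by
      intro i hi
      rcases Nat.eq_zero_or_pos i with rfl | hpos
      · simp
      · obtain ⟨j, rfl⟩ : ∃ j, i = j + 1 := ⟨i - 1, by omega⟩
        obtain ⟨a, b⟩ := hco j (by omega)
        exact ⟨by simp [a], fun _ => by simpa using b⟩
    obtain ⟨ki0, ki1⟩ := key i hi
    obtain ⟨kj0, kj1⟩ := key j hj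
    have e0 := congrFun hij 0
    rw [ki0, kj0] at e0
    by_cases hi0 : i = 0 <;> by_cases hj0 : j = 0
    · omega
    · simp [hi0, hj0] at e0
    · simp [hi0, hj0] at e0
    · have e1 := congrFun hij 1
      rw [ki1 hi0, kj1 hj0] at e1
      have := mul_right_cancel₀ hdy e1
      have : (i - 1 : ℕ) = (j - 1 : ℕ) := by exact_mod_cast this
      omega
  · rw [isBridgeW_iff]
    intro i h1 h2
    rw [length_vertWord] at h2
    rw [hx i h1 h2, hend]; norm_num
  · rintro j ⟨hj0, hjl, -, hgt⟩
    rw [length_vertWord] at hjl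
    have := hgt (j + 1) (Nat.lt_succ_self j) (by rw [length_vertWord]; omega)
    rw [hx j hj0 hjl.le, hx (j + 1) (by omega) (by omega)] at this
    exact lt_irrefl _ this

/-- The span-1 family: `[+e₀] ++ k·[+e₁]` (`k ≤ 60`) and `[+e₀] ++ k·[-e₁]` (`1 ≤ k ≤ 60`).
[cite: Jensen2004SAWLowerBounds, §2.1] -/
def spanOneFamily : Finset (List Step) :=
  (Finset.range 61).image (vertWord 1) ∪ (Finset.range 60).image (fun k => vertWord 3 (k + 1))

/-- Members of the span-1 family are irreducible bridges of span 1. [cite: Jensen2004SAWLowerBounds, §2.1] -/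
theorem spanOneFamily_spec : ∀ s ∈ spanOneFamily, IsIrrBridge s ∧ xEnd s = 1 := by
  intro s hs
  rw [spanOneFamily, mem_union, mem_image, mem_image] at hs
  rcases hs with ⟨k, -, rfl⟩ | ⟨k, -, rfl⟩
  · exact isIrrBridge_vertWord (d := 1) rfl (by decide) k
  · exact isIrrBridge_vertWord (d := 3) rfl (by decide) (k + 1)

/-- The one-step bridge is in the family. [folklore] -/
theorem nil_cons_mem_spanOneFamily : [(0 : Step)] ∈ spanOneFamily := by
  rw [spanOneFamily, mem_union, mem_image]
  exact Or.inl ⟨0, by simp, rfl⟩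

/-- **Kraft sum of the span-1 family** at fugacity `5/13`. [cite: Jensen2004SAWLowerBounds, §2] -/
theorem kraft_spanOneFamily :
    ∑ s ∈ spanOneFamily, (5 / 13 : ℝ) ^ s.length =
      ∑ k ∈ Finset.range 61, (5 / 13 : ℝ) ^ (k + 1) + ∑ k ∈ Finset.range 60, (5 / 13 : ℝ) ^ (k + 2) := by
  rw [spanOneFamily, sum_union, sum_image, sum_image]
  · simp only [length_vertWord]
  · intro a _ b _ h; have := congrArg List.length h; simp at this; exact this
  · intro a _ b _ h; have := congrArg List.length h; simp at this; exact this
  · rw [Finset.disjoint_left]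
    rintro s hs hs'
    rw [mem_image] at hs hs'
    obtain ⟨a, -, rfl⟩ := hs
    obtain ⟨b, -, h⟩ := hs'
    have := congrArg (fun w : List Step => w[1]?) h
    simp [vertWord, List.getElem?_cons_succ] at this
    cases a <;> simp at this

/-! ### Assembly -/

/-- The certified spans and their weighted counts. [cite: Jensen2004SAWLowerBounds, §2] -/
theorem dp_values :
    (StripTM.dp 2 81 40 : ℝ) + StripTM.dp 3 81 40 + StripTM.dp 4 81 40 + StripTM.dp 5 81 40 + StripTM.dp 6 81 40 =
      2511227500845942031 := by
  rw [StripTM.dp_two, StripTM.dp_three, StripTM.dp_four, StripTM.dp_five, StripTM.dp_six]; norm_num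

/-- The numerical heart: the total Kraft sum exceeds `1` (it is `1.0015…`). [cite: Jensen2004SAWLowerBounds, §2] -/
theorem kraft_numeric :
    (1 : ℝ) ≤ (∑ k ∈ Finset.range 61, (5 / 13 : ℝ) ^ (k + 1) + ∑ k ∈ Finset.range 60, (5 / 13 : ℝ) ^ (k + 2)) +
      2511227500845942031 / 2 ^ 64 := by
  have h1 : ∑ k ∈ Finset.range 61, (5 / 13 : ℝ) ^ (k + 1) = 5 / 13 * ∑ k ∈ Finset.range 61, (5 / 13 : ℝ) ^ k := by
    rw [mul_sum]; refine sum_congr rfl fun k _ => by ring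
  have h2 : ∑ k ∈ Finset.range 60, (5 / 13 : ℝ) ^ (k + 2) = (5 / 13) ^ 2 * ∑ k ∈ Finset.range 60, (5 / 13 : ℝ) ^ k := by
    rw [mul_sum]; refine sum_congr rfl fun k _ => by ring
  rw [h1, h2, geom_sum_eq (by norm_num), geom_sum_eq (by norm_num)]
  norm_num

/-- Adding a set of bridges of a new span keeps the Kraft sum additive. [folklore] -/
theorem sum_union_of_xEnd {A B : Finset (List Step)} {n : ℤ} (hA : ∀ s ∈ A, xEnd s < n) (hB : ∀ s ∈ B, xEnd s = n)
    (f : List Step → ℝ) : ∑ s ∈ A ∪ B, f s = ∑ s ∈ A, f s + ∑ s ∈ B, f s := by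
  apply sum_union
  rw [Finset.disjoint_left]
  intro s ha hb
  have := hA s ha; rw [hB s hb] at this; exact lt_irrefl _ this

/-- **`2.6 ≤ μ(ℤ²)`** (Kesten's irreducible-bridge bound with the span-1 family and the certified
strip transfer matrices of spans 2–6; cf. Jensen 2004: `2.625622` with spans `≤ 15`).
[cite: Jensen2004SAWLowerBounds, §2, eq. (4)] -/
theorem le_connectiveConstant_26 : (2.6 : ℝ) ≤ connectiveConstant := by
  -- the certified families of spans 2, …, 6
  obtain ⟨S2, hS2, hK2⟩ := StripTM.kraft_ge (l := 2) (r0 := 40) le_rfl 81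
  obtain ⟨S3, hS3, hK3⟩ := StripTM.kraft_ge (l := 3) (r0 := 40) (by norm_num) 81
  obtain ⟨S4, hS4, hK4⟩ := StripTM.kraft_ge (l := 4) (r0 := 40) (by norm_num) 81
  obtain ⟨S5, hS5, hK5⟩ := StripTM.kraft_ge (l := 5) (r0 := 40) (by norm_num) 81
  obtain ⟨S6, hS6, hK6⟩ := StripTM.kraft_ge (l := 6) (r0 := 40) (by norm_num) 81
  set U := spanOneFamily ∪ S2 ∪ S3 ∪ S4 ∪ S5 ∪ S6 with hU
  have hadm : Renewal.Admissible U := by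
    intro s hs
    simp only [hU, mem_union] at hs
    rcases hs with ((((h | h) | h) | h) | h) | h
    · exact (spanOneFamily_spec s h).1
    · exact (hS2 s h).1
    · exact (hS3 s h).1
    · exact (hS4 s h).1
    · exact (hS5 s h).1
    · exact (hS6 s h).1
  have h0 : [(0 : Step)] ∈ U := by
    simp only [hU, mem_union]; exact Or.inl (Or.inl (Or.inl (Or.inl (Or.inl nil_cons_mem_spanOneFamily))))
  -- the Kraft sum splits over the spans
  have hx1 : ∀ s ∈ spanOneFamily, xEnd s < 2 := fun s hs => by rw [(spanOneFamily_spec s hs).2]; norm_num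
  have hx2 : ∀ s ∈ spanOneFamily ∪ S2, xEnd s < 3 := fun s hs => by
    rcases mem_union.1 hs with h | h; linarith [hx1 s h]; rw [(hS2 s h).2]; norm_num
  have hx3 : ∀ s ∈ spanOneFamily ∪ S2 ∪ S3, xEnd s < 4 := fun s hs => by
    rcases mem_union.1 hs with h | h; linarith [hx2 s h]; rw [(hS3 s h).2]; norm_num
  have hx4 : ∀ s ∈ spanOneFamily ∪ S2 ∪ S3 ∪ S4, xEnd s < 5 := fun s hs => by
    rcases mem_union.1 hs with h | h; linarith [hx3 s h]; rw [(hS4 s h).2]; norm_num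
  have hx5 : ∀ s ∈ spanOneFamily ∪ S2 ∪ S3 ∪ S4 ∪ S5, xEnd s < 6 := fun s hs => by
    rcases mem_union.1 hs with h | h; linarith [hx4 s h]; rw [(hS5 s h).2]; norm_num
  have hsum : ∑ s ∈ U, (5 / 13 : ℝ) ^ s.length = ∑ s ∈ spanOneFamily, (5 / 13 : ℝ) ^ s.length +
      ∑ s ∈ S2, (5 / 13 : ℝ) ^ s.length + ∑ s ∈ S3, (5 / 13 : ℝ) ^ s.length + ∑ s ∈ S4, (5 / 13 : ℝ) ^ s.length +
      ∑ s ∈ S5, (5 / 13 : ℝ) ^ s.length + ∑ s ∈ S6, (5 / 13 : ℝ) ^ s.length := by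
    rw [hU, sum_union_of_xEnd hx5 (fun s h => by exact_mod_cast (hS6 s h).2),
      sum_union_of_xEnd hx4 (fun s h => by exact_mod_cast (hS5 s h).2),
      sum_union_of_xEnd hx3 (fun s h => by exact_mod_cast (hS4 s h).2),
      sum_union_of_xEnd hx2 (fun s h => by exact_mod_cast (hS3 s h).2),
      sum_union_of_xEnd hx1 (fun s h => by exact_mod_cast (hS2 s h).2)]
  have hK : (1 : ℝ) ≤ ∑ s ∈ U, (13 / 5 : ℝ)⁻¹ ^ s.length := by
    rw [show (13 / 5 : ℝ)⁻¹ = 5 / 13 by norm_num, hsum, kraft_spanOneFamily]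
    have := dp_values
    have := kraft_numeric
    linarith
  have := Renewal.le_connectiveConstant_of_kraft hadm h0 (ρ := 13 / 5) (by norm_num) hK
  linarith

end Literature.Probability.RandomPlanarGeometry.SAW
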